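import Mathlib.Analysis.Calculus.ContDiff.Defs
import Mathlib.Analysis.Calculus.Deriv.Basic
import Mathlib.Analysis.SpecialFunctions.Pow.Real
import Mathlib.Analysis.SpecialFunctions.Exp
import Mathlib.MeasureTheory.Integral.IntervalIntegral.Basic
import HarnessLib

/-!
# Tao's cascade ODE (the infinite-dimensional ODE layer of the averaged Navier–Stokes blow-up)

T. Tao, *Finite time blowup for an averaged three-dimensional Navier–Stokes equation*,
J. Amer. Math. Soc. 29 (2016), 601–674 (arXiv:1402.0290v3), §4 and §6. This file vendors the
**pure ODE layer** of the proof of Tao's Thm. 1.5 (the in-tree named fact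
`Literature.Analysis.FluidPDE.tao_averaged_ns_blowup`, barrier entry
`Literature.Barriers.NavierStokesRegularity.TaoAveragedBlowup`). The printed reduction chain is

* Thm. 1.5 ⇐ Thm. 3.2 (local cascade operators are averaged Euler operators) + Thm. 3.3 (blow-up
  for a local cascade equation) [§3, p. 14: "Theorem 1.5 is then an immediate consequence of the
  following two results"];
* Thm. 3.3 ⇐ Lemma 4.1 (equations of motion) + **Thm. 4.2 (ODE blow-up)** [§4, p. 23: "Theorem 3.3
  now follows from the following ODE result"];
* Thm. 4.2 ⇐ §6.1 (dimension `m = 4`, the coefficient Table 2) + **Thm. 6.2 (no global solution for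
  the ODE system (6.0)–(6.8))** [§6.1, p. 31: "To prove Theorem 4.2, it thus suffices to show
  Theorem 6.2"];
* Thm. 6.2 ⇐ Prop. 6.3 (blow-up dynamics) ⇐ Prop. 6.5 (rescaled inductive step), §6.2–6.3.

Here we state, as named facts over elementary real analysis only:

* `TaoCascade.odeBlowup` = Thm. 4.2, with the conclusions (4.5)–(4.11) of Lemma 4.1 packaged as the
  predicate `TaoCascade.CascadeODESolution` (index set `{1,…,m} ↦ Fin m`, shift set
  `S = {(0,0,0),(1,0,0),(0,1,0),(0,0,1)}` = `TaoCascade.shiftSet`, symmetry (4.2) =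
  `IsSymmetricCoeff`, cancellation (4.3) = `IsCancellingCoeff`);
* `TaoCascade.noGlobalODESolution` = Thm. 6.2, with the system (6.0)–(6.8) packaged as
  `TaoCascade.TaoODESystem` (modes `X_{1,n},…,X_{4,n} ↦ X 0 n, …, X 3 n`).

## Conventions / reading of the printed text

* "continuously differentiable `X_{i,n} : [0,+∞) → ℝ`" ↦ functions `ℝ → ℝ` that are `C¹` on
  `Set.Ici 0` (`ContDiffOn ℝ 1`), derivatives taken within `Ici 0` (`derivWithin`, one-sided at `0`).
* `E_{i,n} : [0,+∞) → [0,+∞)` ↦ `ℝ → ℝ`, nonnegative on `Ici 0`.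
* An `O(Y)` term with an *implied constant* (Tao §2) ↦ an explicit constant `K₁`, `K₂`, `C₁`, `C₂`
  (`|… | ≤ K * Y`); "for sufficiently large `n₀` (depending on the implied constants …)" ↦
  `∀ K₁ K₂ ≥ 0, ∃ N₀, ∀ n₀ ≥ N₀`; "`K` sufficiently large depending on `ε₀`" ↦ `∃ K₀, ∀ K ≥ K₀`;
  "`ε` sufficiently small depending on `ε₀, K`" ↦ `∃ e₀ > 0, ∀ ε ∈ (0, e₀]`.
* Powers `(1+ε₀)^{5n/2}`, `(1+ε₀)^{10n}`, `(1+ε₀)^{2n}` with `n ∈ ℤ` are real powers `Real.rpow`.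
* The mode carrying the initial datum (Tao's `i = 1` in (4.7)) is a distinguished index `i₀ : Fin m`
  (a relabelling; in `TaoODESystem` it is `0 : Fin 4`).
* (4.4)/(4.7): `X_{i,n}(0) = 1_{(i,n)=(1,n₀)}`; (4.6): `E_{i,n}(0) = ½ X_{i,n}(0)²`.

What is NOT here: the PDE objects (cascade operators, wavelets `ψ_{i,n}`, Lemma 4.1 itself, Thm.
3.2/3.3) — see `Literature/Analysis/FluidPDE/TaoLocalCascade.lean`; the proof of Thm. 4.2 from
Thm. 6.2 (§6.1, a finite computation with Table 2); Props. 6.3/6.5 and the proof of Thm. 6.2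
(§6.2–6.3, pp. 31–42).

## References

* T. Tao, J. Amer. Math. Soc. 29 (2016), 601–674, §4 (4.1)–(4.11), Lemma 4.1, Thm. 4.2; §6.1
  (6.0)–(6.8), Thm. 6.2. [`Tao2016AveragedNS`]
* N. Katz, N. Pavlović, Trans. Amer. Math. Soc. 357 (2005), 695–708 (the dyadic model (1.13) that
  (4.13) generalises; cited by Tao as [katz-dyadic]).
-/

noncomputable section

open Set MeasureTheory

namespace Literature.Analysis.FluidPDE

namespace TaoCascade

/-! ## Structure constants: the shift set, symmetry and cancellation (Tao §4) -/

/-- The four-element **shift set** `S := {(0,0,0), (1,0,0), (0,1,0), (0,0,1)} ⊂ ℤ³` indexing the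
scale couplings `(μ₁, μ₂, μ₃)` of a cascade operator (Tao 2016, §4, display after (4.1)). It is
invariant under permutations of the three coordinates, which is used in the cancellation condition
(4.3). [cite: Tao2016AveragedNS, §4 after (4.1)] -/
def shiftSet : Finset (ℤ × ℤ × ℤ) :=
  {(0, 0, 0), (1, 0, 0), (0, 1, 0), (0, 0, 1)}

/-- Membership in the shift set, unfolded. [cite: Tao2016AveragedNS, §4 after (4.1)] -/
theorem mem_shiftSet_iff (μ : ℤ × ℤ × ℤ) :
    μ ∈ shiftSet ↔ μ = (0, 0, 0) ∨ μ = (1, 0, 0) ∨ μ = (0, 1, 0) ∨ μ = (0, 0, 1) := by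
  simp [shiftSet]

/-- The **symmetry condition** (4.2) on the structure constants
`α_{i₁,i₂,i₃,μ₁,μ₂,μ₃} = α_{i₂,i₁,i₃,μ₂,μ₁,μ₃}` for `i₁ i₂ i₃ ∈ {1,…,m}` and `(μ₁,μ₂,μ₃) ∈ S`
(it makes the cascade operator (4.1) symmetric). The constants are a total function on
`Fin m × Fin m × Fin m × ℤ³`; only its values on `shiftSet` are ever used. [cite: Tao2016AveragedNS, §4 (4.2)] -/
def IsSymmetricCoeff {m : ℕ} (α : Fin m → Fin m → Fin m → ℤ × ℤ × ℤ → ℝ) : Prop :=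
  ∀ (i₁ i₂ i₃ : Fin m) (μ₁ μ₂ μ₃ : ℤ), (μ₁, μ₂, μ₃) ∈ shiftSet →
    α i₁ i₂ i₃ (μ₁, μ₂, μ₃) = α i₂ i₁ i₃ (μ₂, μ₁, μ₃)

/-- The **cancellation condition** (4.3) on the structure constants:
`∑_{ {a,b,c} = {1,2,3} } α_{i_a,i_b,i_c,μ_a,μ_b,μ_c} = 0` (sum over the six permutations of the three
slots) for all `i₁ i₂ i₃ ∈ {1,…,m}` and `(μ₁,μ₂,μ₃) ∈ S`; it yields the cancellation property
`⟨C(u,u), u⟩ = 0` of the cascade operator (4.1). [cite: Tao2016AveragedNS, §4 (4.3)] -/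
def IsCancellingCoeff {m : ℕ} (α : Fin m → Fin m → Fin m → ℤ × ℤ × ℤ → ℝ) : Prop :=
  ∀ (i₁ i₂ i₃ : Fin m) (μ₁ μ₂ μ₃ : ℤ), (μ₁, μ₂, μ₃) ∈ shiftSet →
    α i₁ i₂ i₃ (μ₁, μ₂, μ₃) + α i₁ i₃ i₂ (μ₁, μ₃, μ₂) + α i₂ i₁ i₃ (μ₂, μ₁, μ₃) +
      α i₂ i₃ i₁ (μ₂, μ₃, μ₁) + α i₃ i₁ i₂ (μ₃, μ₁, μ₂) + α i₃ i₂ i₁ (μ₃, μ₂, μ₁) = 0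

/-- The **quadratic cascade nonlinearity** driving mode `(i, n)`: the main term
`∑_{i₁,i₂ ∈ {1,…,m}} ∑_{(μ₁,μ₂,μ₃) ∈ S} α_{i₁,i₂,i,μ₁,μ₂,μ₃} (1+ε₀)^{5(n-μ₃)/2} X_{i₁,n-μ₃+μ₁} X_{i₂,n-μ₃+μ₂}`
of the equation of motion (4.8) (and of the inviscid/viscous model equations (4.12)–(4.13)),
evaluated at time `t`. [cite: Tao2016AveragedNS, §4 (4.8)] -/
def quadTerm (ε₀ : ℝ) {m : ℕ} (α : Fin m → Fin m → Fin m → ℤ × ℤ × ℤ → ℝ)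
    (X : Fin m → ℤ → ℝ → ℝ) (i : Fin m) (n : ℤ) (t : ℝ) : ℝ :=
  ∑ i₁ : Fin m, ∑ i₂ : Fin m, ∑ μ ∈ shiftSet,
    α i₁ i₂ i μ * (1 + ε₀) ^ ((5 : ℝ) * (n - μ.2.2) / 2) *
      (X i₁ (n - μ.2.2 + μ.1) t * X i₂ (n - μ.2.2 + μ.2.1) t)

/-! ## The conclusions (4.5)–(4.11) of Lemma 4.1 and Theorem 4.2 -/

/-- **The conclusions (i)–(v), (4.5)–(4.11), of Tao's Lemma 4.1 (equations of motion)** for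
families `X_{i,n}, E_{i,n} : [0,+∞) → ℝ` (`i ∈ {1,…,m} ↦ Fin m`, `n ∈ ℤ`), with dyadic parameter
`ε₀`, structure constants `α`, the mode `i₀` carrying the datum (Tao's `i = 1`), the implied
constants `K₁` of (4.8) and `K₂` of (4.10), and the initial scale `n₀`:
(i) a priori regularity (4.5): `sup_{0≤t≤T} sup_n sup_i (1+(1+ε₀)^{10n})|X_{i,n}(t)| < ∞` and the
same for `E_{i,n}^{1/2}`, for every finite `T`; (ii) initial conditions (4.6) `E_{i,n}(0) = ½X_{i,n}(0)²`,
(4.7) `X_{i,n}(0) = 1_{(i,n)=(1,n₀)}`; (iii) the equation of motion (4.8)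
`∂ₜX_{i,n} = [quadTerm] + O((1+ε₀)^{2n} E_{i,n}^{1/2})` and the energy inequality (4.9)
`∂ₜE_{i,n} ≤ [quadTerm]·X_{i,n}`; (iv) the energy defect (4.10)
`½X_{i,n}² ≤ E_{i,n} ≤ ½X_{i,n}² + O((1+ε₀)^{2n} ∫₀ᵗ E_{i,n})`; (v) no very low frequencies (4.11)
`X_{i,n} = E_{i,n} = 0` for `n < n₀`. The functions are `C¹` on `[0,+∞)` with `E ≥ 0` there
(Lemma 4.1 and Thm. 4.2: "continuously differentiable functions `X_{i,n} : [0,+∞) → ℝ` and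
`E_{i,n} : [0,+∞) → [0,+∞)`"); derivatives are one-sided within `[0,+∞)`. See the module docstring
for the reading of `O()` and of the domains. [cite: Tao2016AveragedNS, §4 Lemma 4.1 (4.5)–(4.11)] -/
structure CascadeODESolution (ε₀ : ℝ) {m : ℕ} (i₀ : Fin m)
    (α : Fin m → Fin m → Fin m → ℤ × ℤ × ℤ → ℝ) (K₁ K₂ : ℝ) (n₀ : ℤ)
    (X E : Fin m → ℤ → ℝ → ℝ) : Prop where
  /-- `X_{i,n}` is continuously differentiable on `[0,+∞)`. -/
  contDiffOn_X : ∀ i n, ContDiffOn ℝ 1 (X i n) (Ici 0)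
  /-- `E_{i,n}` is continuously differentiable on `[0,+∞)`. -/
  contDiffOn_E : ∀ i n, ContDiffOn ℝ 1 (E i n) (Ici 0)
  /-- `E_{i,n}` takes values in `[0,+∞)`. -/
  nonneg_E : ∀ i n t, 0 ≤ t → 0 ≤ E i n t
  /-- (4.5), first half: a priori regularity of the coefficients. -/
  apriori_X : ∀ T : ℝ, 0 < T → ∃ M : ℝ, ∀ t ∈ Icc 0 T, ∀ (i : Fin m) (n : ℤ),
    (1 + (1 + ε₀) ^ ((10 : ℝ) * n)) * |X i n t| ≤ M
  /-- (4.5), second half: a priori regularity of the local energies. -/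
  apriori_E : ∀ T : ℝ, 0 < T → ∃ M : ℝ, ∀ t ∈ Icc 0 T, ∀ (i : Fin m) (n : ℤ),
    (1 + (1 + ε₀) ^ ((10 : ℝ) * n)) * Real.sqrt (E i n t) ≤ M
  /-- (4.6): `E_{i,n}(0) = ½ X_{i,n}(0)²`. -/
  init_E : ∀ i n, E i n 0 = (1 / 2) * X i n 0 ^ 2
  /-- (4.7): `X_{i,n}(0) = 1_{(i,n) = (1,n₀)}` (datum `u₀ = ψ_{1,n₀}`, (4.4)). -/
  init_X : ∀ i n, X i n 0 = if i = i₀ ∧ n = n₀ then 1 else 0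
  /-- (4.8): the equation of motion, with implied constant `K₁`. -/
  motion : ∀ i n t, 0 ≤ t →
    |derivWithin (X i n) (Ici 0) t - quadTerm ε₀ α X i n t| ≤
      K₁ * (1 + ε₀) ^ ((2 : ℝ) * n) * Real.sqrt (E i n t)
  /-- (4.9): the local energy inequality. -/
  energy : ∀ i n t, 0 ≤ t → derivWithin (E i n) (Ici 0) t ≤ quadTerm ε₀ α X i n t * X i n t
  /-- (4.10), lower bound: `½ X_{i,n}² ≤ E_{i,n}`. -/
  defect_lower : ∀ i n t, 0 ≤ t → (1 / 2) * X i n t ^ 2 ≤ E i n t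
  /-- (4.10), upper bound, with implied constant `K₂`. -/
  defect_upper : ∀ i n t, 0 ≤ t →
    E i n t ≤ (1 / 2) * X i n t ^ 2 + K₂ * (1 + ε₀) ^ ((2 : ℝ) * n) * ∫ s in (0 : ℝ)..t, E i n s
  /-- (4.11): no very low frequencies, coefficients. -/
  noLow_X : ∀ i n t, n < n₀ → 0 ≤ t → X i n t = 0
  /-- (4.11): no very low frequencies, energies. -/
  noLow_E : ∀ i n t, n < n₀ → 0 ≤ t → E i n t = 0

/-- **Tao's Theorem 4.2 (ODE blow-up).** Let `0 < ε₀ < 1`. Then there exist a natural number `m`,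
structure constants `α_{i₁,i₂,i₃,μ₁,μ₂,μ₃} ∈ ℝ` (`iⱼ ∈ {1,…,m}`, `(μ₁,μ₂,μ₃) ∈ S`) obeying the
symmetry condition (4.2) and the cancellation condition (4.3) (and a mode `i₀`, Tao's `i = 1`,
carrying the datum), with the property that for `n₀` sufficiently large, depending on the implied
constants in (4.8), (4.10), there do not exist continuously differentiable functions
`X_{i,n} : [0,+∞) → ℝ` and `E_{i,n} : [0,+∞) → [0,+∞)` obeying the conclusions (4.5)–(4.11) of
Lemma 4.1. Proved in the source from Thm. 6.2 with `m = 4` (§6.1). A named fact (not asserted).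
[cite: Tao2016AveragedNS, §4 Thm. 4.2] -/
def odeBlowup : Prop :=
  ∀ ε₀ : ℝ, 0 < ε₀ → ε₀ < 1 →
    ∃ (m : ℕ) (i₀ : Fin m) (α : Fin m → Fin m → Fin m → ℤ × ℤ × ℤ → ℝ),
      IsSymmetricCoeff α ∧ IsCancellingCoeff α ∧
        ∀ K₁ K₂ : ℝ, 0 ≤ K₁ → 0 ≤ K₂ → ∃ N₀ : ℤ, ∀ n₀ : ℤ, N₀ ≤ n₀ →
          ¬ ∃ X E : Fin m → ℤ → ℝ → ℝ, CascadeODESolution ε₀ i₀ α K₁ K₂ n₀ X E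

/-! ## The ODE system (6.0)–(6.8) of §6.1 and Theorem 6.2 -/

/-- **The ODE system (6.0)–(6.8) of Tao's §6.1** (dimension `m = 4`, the structure constants of
Table 2, parameters `ε₀, K, ε`, implied constants `C₁` for (6.1)–(6.4) and `C₂` for (6.7), initial
scale `n₀`), for `X_{i,n} : [0,+∞) → ℝ` (`i = 1,…,4 ↦ 0,…,3 : Fin 4`) and the combined energies
`E_n : [0,+∞) → [0,+∞)`: a priori regularity (6.0) for `X_{i,n}` and (display after (6.0)) for
`E_n^{1/2}`; the equations of motion
(6.1) `∂ₜX_{1,n} = (1+ε₀)^{5n/2}(-ε⁻²X_{3,n}X_{4,n} - εX_{1,n}X_{2,n} - ε²e^{-K¹⁰}X_{1,n}X_{3,n} + K X_{4,n-1}²) + O((1+ε₀)^{2n}E_n^{1/2})`,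
(6.2) `∂ₜX_{2,n} = (1+ε₀)^{5n/2}(εX_{1,n}² - ε⁻¹K¹⁰X_{3,n}²) + O(…)`,
(6.3) `∂ₜX_{3,n} = (1+ε₀)^{5n/2}(ε²e^{-K¹⁰}X_{1,n}² + ε⁻¹K¹⁰X_{2,n}X_{3,n}) + O(…)`,
(6.4) `∂ₜX_{4,n} = (1+ε₀)^{5n/2}(ε⁻²X_{3,n}X_{1,n} - (1+ε₀)^{5/2}K X_{4,n}X_{1,n+1}) + O(…)`;
the local energy inequality (6.5)
`∂ₜE_n ≤ (1+ε₀)^{5n/2} K X_{4,n-1}² X_{1,n} - (1+ε₀)^{5(n+1)/2} K X_{4,n}² X_{1,n+1}`; the initial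
conditions (6.6) `E_n(0) = ½·1_{n=n₀}`, `X_{i,n}(0) = 1_{(i,n)=(1,n₀)}`; the energy defect (6.7)
`½∑ᵢX_{i,n}² ≤ E_n ≤ ½∑ᵢX_{i,n}² + O((1+ε₀)^{2n}∫₀ᵗE_n)`; and (6.8) `E_n = X_{i,n} = 0` for
`n < n₀`. Regularity/domain conventions as in `CascadeODESolution`. [cite: Tao2016AveragedNS, §6.1 (6.0)–(6.8)] -/
structure TaoODESystem (ε₀ K ε C₁ C₂ : ℝ) (n₀ : ℤ) (X : Fin 4 → ℤ → ℝ → ℝ) (E : ℤ → ℝ → ℝ) :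
    Prop where
  /-- `X_{i,n}` is continuously differentiable on `[0,+∞)`. -/
  contDiffOn_X : ∀ i n, ContDiffOn ℝ 1 (X i n) (Ici 0)
  /-- `E_n` is continuously differentiable on `[0,+∞)`. -/
  contDiffOn_E : ∀ n, ContDiffOn ℝ 1 (E n) (Ici 0)
  /-- `E_n` takes values in `[0,+∞)`. -/
  nonneg_E : ∀ n t, 0 ≤ t → 0 ≤ E n t
  /-- (6.0): a priori regularity of the coefficients. -/
  apriori_X : ∀ T : ℝ, 0 < T → ∃ M : ℝ, ∀ t ∈ Icc 0 T, ∀ (i : Fin 4) (n : ℤ),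
    (1 + (1 + ε₀) ^ ((10 : ℝ) * n)) * |X i n t| ≤ M
  /-- Display after (6.0): a priori regularity of the combined energies. -/
  apriori_E : ∀ T : ℝ, 0 < T → ∃ M : ℝ, ∀ t ∈ Icc 0 T, ∀ n : ℤ,
    (1 + (1 + ε₀) ^ ((10 : ℝ) * n)) * Real.sqrt (E n t) ≤ M
  /-- (6.1): equation of motion of `X_{1,n}` (the pump/input mode `a`). -/
  eq1 : ∀ n t, 0 ≤ t →
    |derivWithin (X 0 n) (Ici 0) t - (1 + ε₀) ^ ((5 : ℝ) * n / 2) *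
        (-(ε ^ 2)⁻¹ * X 2 n t * X 3 n t - ε * X 0 n t * X 1 n t -
          ε ^ 2 * Real.exp (-K ^ 10) * X 0 n t * X 2 n t + K * X 3 (n - 1) t ^ 2)| ≤
      C₁ * (1 + ε₀) ^ ((2 : ℝ) * n) * Real.sqrt (E n t)
  /-- (6.2): equation of motion of `X_{2,n}`. -/
  eq2 : ∀ n t, 0 ≤ t →
    |derivWithin (X 1 n) (Ici 0) t - (1 + ε₀) ^ ((5 : ℝ) * n / 2) *
        (ε * X 0 n t ^ 2 - ε⁻¹ * K ^ 10 * X 2 n t ^ 2)| ≤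
      C₁ * (1 + ε₀) ^ ((2 : ℝ) * n) * Real.sqrt (E n t)
  /-- (6.3): equation of motion of `X_{3,n}`. -/
  eq3 : ∀ n t, 0 ≤ t →
    |derivWithin (X 2 n) (Ici 0) t - (1 + ε₀) ^ ((5 : ℝ) * n / 2) *
        (ε ^ 2 * Real.exp (-K ^ 10) * X 0 n t ^ 2 + ε⁻¹ * K ^ 10 * X 1 n t * X 2 n t)| ≤
      C₁ * (1 + ε₀) ^ ((2 : ℝ) * n) * Real.sqrt (E n t)
  /-- (6.4): equation of motion of `X_{4,n}` (the output mode, feeding scale `n+1`). -/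
  eq4 : ∀ n t, 0 ≤ t →
    |derivWithin (X 3 n) (Ici 0) t - (1 + ε₀) ^ ((5 : ℝ) * n / 2) *
        ((ε ^ 2)⁻¹ * X 2 n t * X 0 n t -
          (1 + ε₀) ^ ((5 : ℝ) / 2) * K * X 3 n t * X 0 (n + 1) t)| ≤
      C₁ * (1 + ε₀) ^ ((2 : ℝ) * n) * Real.sqrt (E n t)
  /-- (6.5): the local energy inequality for the combined energy `E_n`. -/
  energy : ∀ n t, 0 ≤ t →
    derivWithin (E n) (Ici 0) t ≤
      (1 + ε₀) ^ ((5 : ℝ) * n / 2) * K * X 3 (n - 1) t ^ 2 * X 0 n t -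
        (1 + ε₀) ^ ((5 : ℝ) * (n + 1) / 2) * K * X 3 n t ^ 2 * X 0 (n + 1) t
  /-- (6.6), energies: `E_n(0) = ½ · 1_{n = n₀}`. -/
  init_E : ∀ n, E n 0 = if n = n₀ then 1 / 2 else 0
  /-- (6.6), coefficients: `X_{i,n}(0) = 1_{(i,n) = (1,n₀)}`. -/
  init_X : ∀ i n, X i n 0 = if i = 0 ∧ n = n₀ then 1 else 0
  /-- (6.7), lower bound. -/
  defect_lower : ∀ n t, 0 ≤ t → (1 / 2) * ∑ i, X i n t ^ 2 ≤ E n t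
  /-- (6.7), upper bound, with implied constant `C₂`. -/
  defect_upper : ∀ n t, 0 ≤ t →
    E n t ≤ (1 / 2) * ∑ i, X i n t ^ 2 + C₂ * (1 + ε₀) ^ ((2 : ℝ) * n) * ∫ s in (0 : ℝ)..t, E n s
  /-- (6.8): no very low frequencies, energies. -/
  noLow_E : ∀ n t, n < n₀ → 0 ≤ t → E n t = 0
  /-- (6.8): no very low frequencies, coefficients. -/
  noLow_X : ∀ i n t, n < n₀ → 0 ≤ t → X i n t = 0

/-- **Tao's Theorem 6.2 (No global solution for the ODE system).** Let `0 < ε₀ < 1`, let `K > 0`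
be sufficiently large depending on `ε₀`, let `ε > 0` be sufficiently small depending on `ε₀, K`,
and let `n₀` be sufficiently large depending on `ε₀, K, ε` and the implied constants in
(6.1)–(6.4), (6.7). Then there do not exist continuously differentiable functions
`X_{i,n} : [0,+∞) → ℝ` and `E_n : [0,+∞) → [0,+∞)` obeying (6.0)–(6.8). This is the main technical
result of the paper (proved in §6.2–6.3 via Props. 6.3 and 6.5, pp. 31–42). A named fact (not
asserted). [cite: Tao2016AveragedNS, §6.1 Thm. 6.2] -/
def noGlobalODESolution : Prop :=
  ∀ ε₀ : ℝ, 0 < ε₀ → ε₀ < 1 →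
    ∃ K₀ : ℝ, ∀ K : ℝ, K₀ ≤ K → 0 < K →
      ∃ e₀ : ℝ, 0 < e₀ ∧ ∀ ε : ℝ, 0 < ε → ε ≤ e₀ →
        ∀ C₁ C₂ : ℝ, 0 ≤ C₁ → 0 ≤ C₂ →
          ∃ N₀ : ℤ, ∀ n₀ : ℤ, N₀ ≤ n₀ →
            ¬ ∃ (X : Fin 4 → ℤ → ℝ → ℝ) (E : ℤ → ℝ → ℝ), TaoODESystem ε₀ K ε C₁ C₂ n₀ X E

/-! ## Small API -/

/-- A solution of the cascade conclusions has all modes below the initial scale switched off at all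
times `t ≥ 0` ((4.11), restated for the pair). [cite: Tao2016AveragedNS, §4 (4.11)] -/
theorem CascadeODESolution.eq_zero_of_lt {ε₀ : ℝ} {m : ℕ} {i₀ : Fin m}
    {α : Fin m → Fin m → Fin m → ℤ × ℤ × ℤ → ℝ} {K₁ K₂ : ℝ} {n₀ : ℤ} {X E : Fin m → ℤ → ℝ → ℝ}
    (h : CascadeODESolution ε₀ i₀ α K₁ K₂ n₀ X E) {i : Fin m} {n : ℤ} {t : ℝ} (hn : n < n₀)
    (ht : 0 ≤ t) : X i n t = 0 ∧ E i n t = 0 :=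
  ⟨h.noLow_X i n t hn ht, h.noLow_E i n t hn ht⟩

/-- The initial energy of a solution of the cascade conclusions is `½` on the datum mode
`(i₀, n₀)` and `0` elsewhere ((4.6) with (4.7)). [cite: Tao2016AveragedNS, §4 (4.6)–(4.7)] -/
theorem CascadeODESolution.init_E_eq {ε₀ : ℝ} {m : ℕ} {i₀ : Fin m}
    {α : Fin m → Fin m → Fin m → ℤ × ℤ × ℤ → ℝ} {K₁ K₂ : ℝ} {n₀ : ℤ} {X E : Fin m → ℤ → ℝ → ℝ}
    (h : CascadeODESolution ε₀ i₀ α K₁ K₂ n₀ X E) (i : Fin m) (n : ℤ) :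
    E i n 0 = if i = i₀ ∧ n = n₀ then 1 / 2 else 0 := by
  rw [h.init_E, h.init_X]
  split_ifs <;> norm_num

/-- In the ODE system (6.0)–(6.8) the initial energy is carried entirely by the datum mode:
`∑ᵢ ½ X_{i,n}(0)² = E_n(0)` ((6.6)). [cite: Tao2016AveragedNS, §6.1 (6.6)] -/
theorem TaoODESystem.half_sum_sq_init {ε₀ K ε C₁ C₂ : ℝ} {n₀ : ℤ} {X : Fin 4 → ℤ → ℝ → ℝ}
    {E : ℤ → ℝ → ℝ} (h : TaoODESystem ε₀ K ε C₁ C₂ n₀ X E) (n : ℤ) :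
    (1 / 2) * ∑ i, X i n 0 ^ 2 = E n 0 := by
  simp only [h.init_X, h.init_E, Fin.sum_univ_four]
  by_cases hn : n = n₀ <;> simp [hn]

end TaoCascade

end Literature.Analysis.FluidPDE
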